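import Mathlib

/-!
# Elementary cores of the greedy-flag reduction (DENSITY-XY G.51‴–G.53): step ≤ jump², first step ≤ 4·Var/w_max, box integral

Kernel anchors for `DENSITY-XY.md` ADDENDA G.51‴(b1), G.52 (THEOREM D) and G.53(a) (repair cell
b2b-imbrie, XY / free-fermion rung).  Along the greedy (weighted-Leja) flag the Christoffel T-weights
`û_k = T_k(j_k) = max_i T_k(i)` evolve by `T_{k+1}(i) = T_k(i) (ν_i - ν_{j_k})²`, so the step ratio is
`û_{k+1}/û_k = T_k(i) d² / T_k(j_k)` with `T_k(i) ≤ T_k(j_k)`: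

* `step_ratio_le_jump_sq` — `T_i ≤ T_j`, `0 < T_j` give `T_i d² / T_j ≤ d²` (G.51‴(b1); with
  `d ≤ diam ν` this is the whole input of THEOREM D: `K_n(ν) ≤ (diam ν)^{n-1} · n!`);
* `weighted_sq_dist_le_four_var` — if `w_i ≤ w_j` and both atoms satisfy the one-atom Chebyshev bound
  `w (x - m)² ≤ V` (e.g. `V = Var_w`, `m` = mean), then `w_i (x_i - x_j)² ≤ 4 V` (G.53(a));
* `first_step_ratio_le` — hence the first greedy step ratio obeys `w_i (x_i - x_j)² / w_j ≤ 4 V / w_j`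
  (`≤ 4n` on `B̄`, where `V ≤ 1` and `w_j = w_max ≥ 1/n`);
* `inv_sqrt_box_integral` — the one-dimensional flag-box integral `∫_0^a ρ^{-1/2} dρ = 2 √a` behind
  THEOREM G / G′ (each Haar factor `dρ/ρ` against the majorant `ρ^{1/2}`).

Elementary real analysis only; nothing here asserts CONJECTURE U or anything about the interacting chain.
-/

namespace Literature.MathematicalPhysics.QuantumLattice.Imbrie2016

/-- **Greedy step ≤ jump².**  If the next pick's current T-weight does not exceed the current maximum,
`Ti ≤ Tj`, `0 < Tj`, then the step ratio `Ti * d^2 / Tj` is at most `d^2`.  [folklore] -/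
theorem step_ratio_le_jump_sq (Ti Tj d : ℝ) (hTj : 0 < Tj) (hle : Ti ≤ Tj) :
    Ti * d ^ 2 / Tj ≤ d ^ 2 := by
  rw [div_le_iff₀ hTj]
  have hd : 0 ≤ d ^ 2 := sq_nonneg d
  nlinarith [mul_le_mul_of_nonneg_right hle hd]

/-- **Two Chebyshev atoms.**  `0 ≤ wi ≤ wj`, `wi (xi - m)² ≤ V`, `wj (xj - m)² ≤ V` imply
`wi (xi - xj)² ≤ 4 V`: split `(xi - xj)² ≤ 2 (xi - m)² + 2 (xj - m)²` and use `wi ≤ wj` on the second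
term.  [folklore] -/
theorem weighted_sq_dist_le_four_var (wi wj xi xj m V : ℝ) (hwi : 0 ≤ wi) (hle : wi ≤ wj)
    (hVi : wi * (xi - m) ^ 2 ≤ V) (hVj : wj * (xj - m) ^ 2 ≤ V) :
    wi * (xi - xj) ^ 2 ≤ 4 * V := by
  have h1 : wi * (xj - m) ^ 2 ≤ V :=
    le_trans (mul_le_mul_of_nonneg_right hle (sq_nonneg _)) hVj
  have h2 : (xi - xj) ^ 2 ≤ 2 * (xi - m) ^ 2 + 2 * (xj - m) ^ 2 := by
    nlinarith [sq_nonneg (xi + xj - 2 * m)]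
  have h3 : wi * (xi - xj) ^ 2 ≤ wi * (2 * (xi - m) ^ 2 + 2 * (xj - m) ^ 2) :=
    mul_le_mul_of_nonneg_left h2 hwi
  nlinarith [h1, h3, hVi]

/-- **First greedy step ≤ 4V / w_max.**  Under the hypotheses of `weighted_sq_dist_le_four_var` and
`0 < wj`, the first step ratio `wi (xi - xj)² / wj` is at most `4 V / wj`.  [folklore] -/
theorem first_step_ratio_le (wi wj xi xj m V : ℝ) (hwi : 0 ≤ wi) (hwj : 0 < wj) (hle : wi ≤ wj)
    (hVi : wi * (xi - m) ^ 2 ≤ V) (hVj : wj * (xj - m) ^ 2 ≤ V) :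
    wi * (xi - xj) ^ 2 / wj ≤ 4 * V / wj := by
  rw [div_eq_mul_inv, div_eq_mul_inv]
  exact mul_le_mul_of_nonneg_right
    (weighted_sq_dist_le_four_var wi wj xi xj m V hwi hle hVi hVj) (inv_nonneg.mpr hwj.le)

/-- **Flag-box factor.**  `∫_0^a ρ^{-1/2} dρ = 2 √a` (for `a < 0` both sides vanish): the one-dimensional integral that
turns each Haar factor `dρ_k/ρ_k` against the majorant `ρ_k^{1/2}` into the constant `2C/√G_k` in
THEOREM G.  [folklore] -/
theorem inv_sqrt_box_integral (a : ℝ) :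
    ∫ ρ in (0:ℝ)..a, ρ ^ (-(1/2 : ℝ)) = 2 * Real.sqrt a := by
  rw [integral_rpow (Or.inl (by norm_num : (-1 : ℝ) < -(1/2 : ℝ)))]
  have e : (-(1/2 : ℝ)) + 1 = 1/2 := by norm_num
  rw [e, Real.zero_rpow (by norm_num : (1/2 : ℝ) ≠ 0), Real.sqrt_eq_rpow]
  ring

end Literature.MathematicalPhysics.QuantumLattice.Imbrie2016
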